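import Summits.MatrixMultiplication.MatrixMultiplication.Theorems.AbelianSTPPCensusTAKnapDefs

/-!
# T_A/450 certificate: kernel evaluation, volumes `231 … 330` (segment 4)

Cell mm-stpp (rung F-M1), leaf `NoAbelianSTPPHost_2371_450`; checker and checkpoint rows in `AbelianSTPPCensusTAKnapDefs.lean`.
`decide` with kernel reduction (standard axioms, default heartbeats; no `native_decide`).  Each segment recomputes the next
checkpoint row from the previous one and checks every order `338 … 450` against every volume of its range; consumed by
`TAKnap.seg_sound` / `TAKnap.loopVR_sound` in `AbelianSTPPCensusLeafTA450Closed.lean`.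
WHAT THIS IS NOT: arithmetic on shape lists only; no statement about STPP families or `ω`.
-/

set_option linter.dupNamespace false
set_option autoImplicit false

namespace Summit.MatrixMultiplication.MatrixMultiplication.Theorems.TAKnap

/-- Segment 4: volumes `231 … 330` from `row230` reach the checkpoint `row330`, all order checks `338 … 450` passing. [original] -/
theorem seg4 : loopVR 338 113 100 231 row230 = (true, row330) := by decide +kernel

end Summit.MatrixMultiplication.MatrixMultiplication.Theorems.TAKnap
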